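import Summits.CriticalPhenomena.Ising3DConformalLimit.Theses.PerfectScreening
import Summits.CriticalPhenomena.Ising3DConformalLimit.Theorems.CoulombImpliesNontrivial.Negative.Antecedent
import Summits.CriticalPhenomena.Ising3DConformalLimit.Theorems.CoulombImpliesNontrivial.Negative.LatticeShadow
import Summits.CriticalPhenomena.Ising3DConformalLimit.Theorems.CanonicalBranchRefutationCanonicalDimensionIsWick
import Summits.CriticalPhenomena.Ising3DConformalLimit.Theorems.CanonicalBranchRefutationIsingLimitHeritage

/-!
# The Coulomb branch of `PerfectScreening.closes` is FREE — what crux r3 really asks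
(crux-ideate round 2, ideator 5, crux stmt-CriticalPhenomena-13885 `CoulombImpliesNontrivial`; 2026-08-17)

All theorems below are sorry-free COMPOSITIONS of landed tree theorems:
* `CanonicalDimensionIsWick_of_stubs` (route CanonicalBranchRefutation, crux stmt-15520, PROVED):
  a pointwise lattice scaling limit on `ℝ³` that is OS-positive along the axes, GKS/Lebowitz-sandwiched,
  non-degenerate and Möbius covariant with `Δ = 1/2` has `U₄ ≡ 0` off the diagonals
  (Kelvin weight = conformal weight at `Δ = (d-2)/2`; OS null vector `Δφ·Ω`; removable singularities; Liouville);
* `IsingLimitHeritage_of_stubs` (stmt-15523, PROVED): every pointwise limit of `criticalCorr 3` inherits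
  axis RP, the three GKS pairings and Lebowitz;
* `moebiusDimension_eq_half_of_coulomb` (this crux's `Negative/Antecedent.lean`): under the Coulomb
  antecedent a Möbius-covariant non-degenerate limit has `Δ = 1/2`;
* `coulomb_iff_not_nonSaturation` (ibid.): the antecedent is `¬ NonSaturation` (stmt-1342).

## Results
* `coulomb_moebius_limit_wick` / `coulomb_moebius_limit_not_hasNontrivialU4` (**R1**): in the Coulomb world
  EVERY Möbius-covariant non-degenerate pointwise limit of the critical Ising₃ correlators is Wick. Hence the
  conclusion `HasNontrivialU4 S` of r3 is FALSE on exactly the limits `(ρ, Δ, S)` that the route's deciding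
  theorem `PerfectScreening.closes` feeds it (those come from `MoebiusLimitExists` and carry
  `IsMoebiusCovariant Δ S`): on that branch r3 can only ever be used VACUOUSLY.
* `MoebiusForcesScreening` (**r3'**) := a Möbius-covariant non-degenerate pointwise limit forces
  `NonSaturation` (weak `η(3) > 0`). `moebiusForcesScreening_of_crux` (**R2**): r3 ⟹ r3'.
  `closes'` (**R3**): the route's deciding theorem re-proved with r3 REPLACED by the weaker r3'
  (same other five hypotheses, same conclusion `Ising3DConformalLimit`).
* `moebiusForcesScreening_iff_noFreeCoulombLimit` (**R4**): r3' is EXACTLY the exclusion of a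
  Coulomb-normalised FREE Möbius limit — "the massless free field with `Z > 0` is not the conformal scaling
  limit of n.n. Ising₃" (the `¬GFP⁺` statement of the planner notes).
* `latticeShadow_moebiusForcesScreening_false` (**R6**): the LATTICE SHADOW of r3' is false — an arbitrary
  lattice family with two-sided Coulomb two-point function CAN have a free Möbius limit (the massless free
  family sampled on `ℤ³`); so any proof of r3' (a fortiori of r3) must use Ising dynamics (random currents /
  `σ² = 1` / Lee–Yang / DLR), not kinematics: r3' is the non-triviality core in its sharpest dress.
* `crux_iff_moebiusForcesScreening_and_nonMoebius` (**R5**): r3 ⟺ r3' ∧ (Coulomb ⟹ every non-degenerate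
  limit that is Möbius covariant for NO `Δ` is interacting) — the second conjunct is what r3 demands beyond
  anything the route uses.
-/

noncomputable section

namespace Summit.CriticalPhenomena.Ising3DConformalLimit.Cruxes.CoulombImpliesNontrivial.CoulombBranchIsFree

open Literature.Probability.LatticeModels Filter Set
open Summit.CriticalPhenomena.Ising3DConformalLimit.Theses.PerfectScreening
open Summit.CriticalPhenomena.Ising3DConformalLimit.CoulombImpliesNontrivialNegative
open Summit.CriticalPhenomena.Ising3DConformalLimit.Cruxes

/-- The antecedent of r3 (Coulomb lower bound on the critical two-point function). -/
abbrev Coulomb : Prop :=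
  ∃ c : ℝ, 0 < c ∧ ∀ x : Site 3, x ≠ 0 → c / ‖x‖ ≤ criticalTwoPoint 3 x

/-- **R1. In the Coulomb world every Möbius-covariant non-degenerate pointwise limit is Wick.** -/
theorem coulomb_moebius_limit_wick (hC : Coulomb) {ρ : ℝ → ℝ} {Δ : ℝ} {S : CorrFamily 3}
    (hρ : ∀ δ ∈ Set.Ioc (0:ℝ) 1, 0 < ρ δ) (hlim : HasPointwiseScalingLimit (criticalCorr 3) ρ S)
    (hnd : IsNondegenerateTwoPoint S) (hM : IsMoebiusCovariant Δ S) :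
    ∀ x ∈ NonCoincident 3 4, limitConnectedFour S x = 0 := by
  have hΔ : Δ = 1 / 2 := moebiusDimension_eq_half_of_coulomb hC hρ hlim hnd hM
  subst hΔ
  obtain ⟨hRP, hGKS, hLeb⟩ := IsingLimitHeritage.Birth.IsingLimitHeritage_of_stubs ρ S hρ hlim
  exact CanonicalDimensionIsWick.Birth.CanonicalDimensionIsWick_of_stubs S ⟨criticalCorr 3, ρ, hlim⟩
    hRP hGKS hLeb hnd hM

/-- **R1'.** The conclusion of r3 fails on every Möbius-covariant non-degenerate limit of the Coulomb world. -/
theorem coulomb_moebius_limit_not_hasNontrivialU4 (hC : Coulomb) {ρ : ℝ → ℝ} {Δ : ℝ} {S : CorrFamily 3}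
    (hρ : ∀ δ ∈ Set.Ioc (0:ℝ) 1, 0 < ρ δ) (hlim : HasPointwiseScalingLimit (criticalCorr 3) ρ S)
    (hnd : IsNondegenerateTwoPoint S) (hM : IsMoebiusCovariant Δ S) : ¬ HasNontrivialU4 S :=
  fun ⟨x, hx, hne⟩ => hne (coulomb_moebius_limit_wick hC hρ hlim hnd hM x hx)

/-- **r3'** — the honest replacement of r3 for this route: a Möbius-covariant non-degenerate pointwise
scaling limit of the critical Ising₃ correlators forces weak `η(3) > 0` (`NonSaturation`, stmt-1342). -/
def MoebiusForcesScreening : Prop :=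
  ∀ (ρ : ℝ → ℝ) (Δ : ℝ) (S : CorrFamily 3), (∀ δ ∈ Set.Ioc (0:ℝ) 1, 0 < ρ δ) →
    HasPointwiseScalingLimit (criticalCorr 3) ρ S → IsNondegenerateTwoPoint S →
    IsMoebiusCovariant Δ S → NonSaturation

/-- **R2. r3 implies r3'.** -/
theorem moebiusForcesScreening_of_crux (h : CoulombImpliesNontrivial) : MoebiusForcesScreening := by
  intro ρ Δ S hρ hlim hnd hM
  by_contra hNS
  have hC : Coulomb := coulomb_iff_not_nonSaturation.2 hNS
  exact coulomb_moebius_limit_not_hasNontrivialU4 hC hρ hlim hnd hM (h hC ρ S hρ hlim hnd)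

/-- **R3. The route's deciding theorem with r3 replaced by the WEAKER r3'** (same other hypotheses,
same conclusion; compare `PerfectScreening.closes`). -/
theorem closes'
    (h_SubharmonicOffOrigin : SubharmonicOffOrigin)
    (h_MoebiusForcesScreening : MoebiusForcesScreening)
    (h_GaussianLimitNotScreened : GaussianLimitNotScreened)
    (h_MoebiusLimitExists : MoebiusLimitExists)
    (h_GreenAsymptotics : GreenAsymptotics)
    (h_ScreeningDichotomy : ScreeningDichotomy) :
    _root_.Ising3DConformalLimit := by
  obtain ⟨ρ, Δ, S, hρ, hΔ, hlim, hnd, hM⟩ := h_MoebiusLimitExists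
  refine ⟨ρ, Δ, S, hρ, hΔ, hlim, hnd, hM, ?_⟩
  by_contra hU4
  rcases h_ScreeningDichotomy h_GreenAsymptotics h_SubharmonicOffOrigin with hCoulomb | hScreened
  · -- Coulomb branch: EMPTY, by r3' (no appeal to U₄ at all)
    exact (coulomb_iff_not_nonSaturation.1 hCoulomb) (h_MoebiusForcesScreening ρ Δ S hρ hlim hnd hM)
  · exact h_GaussianLimitNotScreened ρ Δ S hρ hlim hnd hM hU4 hScreened

/-- **R4. What r3' is**: the exclusion of a Coulomb-normalised FREE Möbius-covariant limit
("the massless free field with `Z > 0` is not the conformal scaling limit of n.n. Ising₃"). The Wick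
clause on the right is REDUNDANT by R1 — that is the point. -/
theorem moebiusForcesScreening_iff_noFreeCoulombLimit :
    MoebiusForcesScreening ↔
      ¬ (Coulomb ∧ ∃ (ρ : ℝ → ℝ) (Δ : ℝ) (S : CorrFamily 3), (∀ δ ∈ Set.Ioc (0:ℝ) 1, 0 < ρ δ) ∧
          HasPointwiseScalingLimit (criticalCorr 3) ρ S ∧ IsNondegenerateTwoPoint S ∧
          IsMoebiusCovariant Δ S ∧ ∀ x ∈ NonCoincident 3 4, limitConnectedFour S x = 0) := by
  constructor
  · rintro h ⟨hC, ρ, Δ, S, hρ, hlim, hnd, hM, -⟩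
    exact (coulomb_iff_not_nonSaturation.1 hC) (h ρ Δ S hρ hlim hnd hM)
  · intro h ρ Δ S hρ hlim hnd hM
    by_contra hNS
    have hC : Coulomb := coulomb_iff_not_nonSaturation.2 hNS
    exact h ⟨hC, ρ, Δ, S, hρ, hlim, hnd, hM, coulomb_moebius_limit_wick hC hρ hlim hnd hM⟩

/-- **R5. What r3 asks beyond r3'**: non-triviality, in the Coulomb world, of those non-degenerate limits
that are Möbius covariant for NO dimension `Δ` (limits nobody in the route uses). -/
theorem crux_iff_moebiusForcesScreening_and_nonMoebius :
    CoulombImpliesNontrivial ↔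
      (MoebiusForcesScreening ∧
        (Coulomb → ∀ (ρ : ℝ → ℝ) (S : CorrFamily 3), (∀ δ ∈ Set.Ioc (0:ℝ) 1, 0 < ρ δ) →
          HasPointwiseScalingLimit (criticalCorr 3) ρ S → IsNondegenerateTwoPoint S →
          (∀ Δ : ℝ, ¬ IsMoebiusCovariant Δ S) → HasNontrivialU4 S)) := by
  constructor
  · intro h
    exact ⟨moebiusForcesScreening_of_crux h, fun hC ρ S hρ hlim hnd _ => h hC ρ S hρ hlim hnd⟩
  · rintro ⟨hMFS, hrest⟩ hC ρ S hρ hlim hnd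
    by_cases hM : ∃ Δ : ℝ, IsMoebiusCovariant Δ S
    · obtain ⟨Δ, hM⟩ := hM
      exact absurd (hMFS ρ Δ S hρ hlim hnd hM) (coulomb_iff_not_nonSaturation.1 hC)
    · exact hrest hC ρ S hρ hlim hnd (not_exists.1 hM)

/-- **R6. The lattice shadow of r3' is FALSE**: for an arbitrary lattice family with a two-sided Coulomb
two-point function, "Möbius non-degenerate limit ⟹ contradiction" fails — the massless free family sampled on
`ℤ³` has the free Möbius limit `gffFamily (1/2)` under `ρ = δ^{-1/2}`. Hence r3' (and r3) need Ising DYNAMICS. -/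
theorem latticeShadow_moebiusForcesScreening_false :
    ¬ ∀ G : LatticeCorrFamily 3,
      (∃ c : ℝ, 0 < c ∧ ∀ x : Site 3, x ≠ 0 → c / ‖x‖ ≤ G 2 ![0, x]) →
      (∃ C : ℝ, ∀ x : Site 3, x ≠ 0 → G 2 ![0, x] ≤ C / ‖x‖) →
      ∀ (ρ : ℝ → ℝ) (Δ : ℝ) (S : CorrFamily 3), (∀ δ ∈ Set.Ioc (0:ℝ) 1, 0 < ρ δ) →
        HasPointwiseScalingLimit G ρ S → IsNondegenerateTwoPoint S → IsMoebiusCovariant Δ S → False := by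
  intro h
  refine h (sampleOnLattice (gffFamily (1/2))) ?_ ?_ (fun δ => δ ^ (-(1/2:ℝ))) (1/2)
    (gffFamily (1/2)) (fun δ hδ => Real.rpow_pos_of_pos hδ.1 _) (hasPointwiseScalingLimit_gff_sample (1/2))
    (isNondegenerateTwoPoint_gff _) (isMoebiusCovariant_gff _)
  · refine ⟨1/2, by norm_num, fun x hx => ?_⟩
    rw [sampleOnLattice_gff_half_two]
    have hx1 : (0:ℝ) < ‖x‖ := norm_pos_iff.2 hx
    have h2 := norm_siteVec_le x
    have hpos : 0 < ‖siteVec x‖ := hx1.trans_le (norm_le_norm_siteVec x)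
    rw [div_le_div_iff₀ hx1 hpos]
    linarith
  · refine ⟨1, fun x hx => ?_⟩
    rw [sampleOnLattice_gff_half_two]
    have hx1 : (0:ℝ) < ‖x‖ := norm_pos_iff.2 hx
    exact one_div_le_one_div_of_le hx1 (norm_le_norm_siteVec x)

end Summit.CriticalPhenomena.Ising3DConformalLimit.Cruxes.CoulombImpliesNontrivial.CoulombBranchIsFree

end
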